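import Summits.NavierStokesRegularity.NavierStokesRegularity.Theorems.TypeIIInviscidRelaxationAxisymSwirlRegularZhangBarrierRiccatiKappa
import HarnessLib

/-!
# Toward the κ-inflow barriers, `κ ∈ (0,1]`: the explicit tail profile `φ_κ` and its Riccati inequality

Helper toward the crux `AxisymSwirlRegular` (stmt-NavierStokesRegularity-1964, route TypeIIInviscidRelaxation),
registered line `radial_inflow_split`, criterion side (⟨19059⟩); continuation of `…ZhangBarrierRiccatiKappa`.

THIS FILE instantiates the abstract inequality `ZhangBarrier.riccati_abstract` on the concrete functions of the
κ-recipe (`0 < κ ≤ 1`, `M > 0`): with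
`h(ξ) = (M/κ) ξ^κ`, `D(ξ) = ξ − 2M ξ^{κ−1}`, `A = 32 e^{M(1+2M)/κ}`, `m = 1/(16(A+2))`,
`φ_κ(ξ) = A e^{−h(ξ)} + 2/√(1+D(ξ)²)`, `φ_κ′(ξ) = −A M ξ^{κ−1} e^{−h} − 2 D D′/√(1+D²)³`, `D′ = 1 + 2M(1−κ)ξ^{κ−2}`,
it proves `hasDerivAt_phiK` (on `ξ > 0`) and **`riccati_le_kappa`**:
`φ_κ′ + (M ξ^{κ−1} − 1/ξ − ξ/2) φ_κ + m φ_κ² ≤ −1` on `(0,∞)` — the Riccati inequality that makes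
`v = exp(m ∫φ_κ)` the outer factor of a self-similar supersolution for the envelope `M r^{κ−1}(T−t)^{−κ/2}`
(`F″ + (Mξ^{κ−1} − 1/ξ − ξ/2)F′ + mF ≤ 0` with `F = u·v`, `u′ = ξ e^{−h−ξ}`; see the module docstring of
`…RiccatiKappa` and hand 2-g1's census on ⟨1964⟩ for the remaining calculus: interval-integral `u`, `ψ`, and the
`ξ^{2m}` bounds).  At `κ = 1`: `D = ξ − 2M`, `h = Mξ` — the construction of `…ZhangBarrierRiccati` with a larger `A`.

Key facts used: `Mξ^{κ−1} = (ξ − D)/2` (definition of `D`), `D′ = (2−κ) − (1−κ)D/ξ` (`ξ^{κ−2} = ξ^{κ−1}/ξ`),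
`D < ξ`, and `D < 1 ⇒ ξ^κ ≤ 1 + 2M ⇒ A e^{−h} ≥ 32`.

Pure Mathlib real analysis; no NS statement here. [new]
-/

noncomputable section

set_option linter.dupNamespace false

open Set Real

namespace Summit.NavierStokesRegularity.NavierStokesRegularity.Theorems.ZhangBarrier

/-- Amplitude of the κ-recipe, `A_κ(M) = 32 e^{M(1+2M)/κ}`. [new] -/
def bigAK (κ M : ℝ) : ℝ := 32 * exp (M * (1 + 2 * M) / κ)

/-- Exponent of the κ-recipe, `m_κ = 1/(16(A_κ+2))`. [new] -/
def expoK (κ M : ℝ) : ℝ := 1 / (16 * (bigAK κ M + 2))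

/-- `h(ξ) = (M/κ) ξ^κ`, the primitive of the drift `M ξ^{κ−1}`. [new] -/
def hK (κ M ξ : ℝ) : ℝ := M / κ * ξ ^ κ

/-- The deformed tail variable `D(ξ) = ξ − 2M ξ^{κ−1}`. [new] -/
def DK (κ M ξ : ℝ) : ℝ := ξ - 2 * M * ξ ^ (κ - 1)

/-- `D′(ξ) = 1 + 2M(1−κ) ξ^{κ−2}`. [new] -/
def dDK (κ M ξ : ℝ) : ℝ := 1 + 2 * M * (1 - κ) * ξ ^ (κ - 2)

/-- The tail profile `φ_κ = A e^{−h} + 2/√(1+D²)`. [new] -/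
def phiK (κ M ξ : ℝ) : ℝ := bigAK κ M * exp (-hK κ M ξ) + 2 / √(1 + DK κ M ξ ^ 2)

/-- `φ_κ′ = −A M ξ^{κ−1} e^{−h} − 2 D D′/√(1+D²)³`. [new] -/
def dphiK (κ M ξ : ℝ) : ℝ :=
  -(bigAK κ M * (M * ξ ^ (κ - 1)) * exp (-hK κ M ξ)) - 2 * DK κ M ξ * dDK κ M ξ / √(1 + DK κ M ξ ^ 2) ^ 3

/-- `A_κ > 0`. -/
theorem bigAK_pos (κ M : ℝ) : 0 < bigAK κ M := by unfold bigAK; positivity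

/-- `m_κ > 0`. -/
theorem expoK_pos (κ M : ℝ) : 0 < expoK κ M := by unfold expoK; have := bigAK_pos κ M; positivity

/-- `16(A_κ+2) m_κ = 1`. -/
theorem expoK_mul (κ M : ℝ) : 16 * (bigAK κ M + 2) * expoK κ M = 1 := by
  unfold expoK; have := bigAK_pos κ M; field_simp

/-- `h′ = M ξ^{κ−1}` on `ξ > 0`. -/
theorem hasDerivAt_hK {κ M ξ : ℝ} (hκ : κ ≠ 0) (hξ : 0 < ξ) :
    HasDerivAt (hK κ M) (M * ξ ^ (κ - 1)) ξ := by
  have h := (hasDerivAt_rpow_const (p := κ) (Or.inl hξ.ne')).const_mul (M / κ)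
  refine h.congr_deriv ?_
  field_simp

/-- `D′ = dDK` on `ξ > 0`. -/
theorem hasDerivAt_DK {κ M ξ : ℝ} (hξ : 0 < ξ) : HasDerivAt (DK κ M) (dDK κ M ξ) ξ := by
  have h1 := (hasDerivAt_rpow_const (p := κ - 1) (Or.inl hξ.ne')).const_mul (2 * M)
  have h : HasDerivAt (fun x => x - 2 * M * x ^ (κ - 1)) (1 - 2 * M * ((κ - 1) * ξ ^ (κ - 1 - 1))) ξ :=
    (hasDerivAt_id' ξ).sub h1
  refine h.congr_deriv ?_
  simp only [dDK, show κ - 1 - 1 = κ - 2 by ring]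
  ring

/-- `φ_κ′ = dphiK` on `ξ > 0`. -/
theorem hasDerivAt_phiK {κ M ξ : ℝ} (hκ : κ ≠ 0) (hξ : 0 < ξ) :
    HasDerivAt (phiK κ M) (dphiK κ M ξ) ξ := by
  have h1 := ((hasDerivAt_hK (M := M) hκ hξ).neg.exp).const_mul (bigAK κ M)
  have hpos : 1 + DK κ M ξ ^ 2 ≠ 0 := by positivity
  have hsq : √(1 + DK κ M ξ ^ 2) ≠ 0 := by positivity
  have h2 : HasDerivAt (fun x => 1 + DK κ M x ^ 2) (((2 : ℕ) : ℝ) * DK κ M ξ ^ (2 - 1) * dDK κ M ξ) ξ :=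
    ((hasDerivAt_DK (κ := κ) (M := M) hξ).pow 2).const_add 1
  have h3 := h2.sqrt hpos
  have h4 := (hasDerivAt_const ξ (2 : ℝ)).fun_div h3 hsq
  have h : HasDerivAt (fun x => bigAK κ M * exp (-hK κ M x) + 2 / √(1 + DK κ M x ^ 2))
      (bigAK κ M * (exp (-hK κ M ξ) * -(M * ξ ^ (κ - 1)))
        + (0 * √(1 + DK κ M ξ ^ 2) - 2 * (((2 : ℕ) : ℝ) * DK κ M ξ ^ (2 - 1) * dDK κ M ξ
            / (2 * √(1 + DK κ M ξ ^ 2)))) / √(1 + DK κ M ξ ^ 2) ^ 2) ξ :=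
    h1.add h4
  refine h.congr_deriv ?_
  simp only [dphiK]
  norm_num
  field_simp
  ring

/-- `D < ξ` (since `ξ^{κ−1} > 0`). -/
theorem DK_lt {κ M ξ : ℝ} (hM : 0 < M) (hξ : 0 < ξ) : DK κ M ξ < ξ := by
  unfold DK
  have : 0 < ξ ^ (κ - 1) := rpow_pos_of_pos hξ _
  nlinarith

/-- The structural identity `D′ = (2−κ) − (1−κ) D/ξ`. -/
theorem dDK_eq {κ M ξ : ℝ} (hξ : 0 < ξ) : dDK κ M ξ = (2 - κ) - (1 - κ) * DK κ M ξ / ξ := by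
  unfold dDK DK
  have e : ξ ^ (κ - 2) = ξ ^ (κ - 1) / ξ := by
    rw [show κ - 2 = κ - 1 - 1 by ring, rpow_sub_one hξ.ne']
  rw [e]
  field_simp
  ring

/-- On the region `D < 1` the exponential part is large: `A e^{−h} ≥ 32`. Indeed `D < 1` forces `ξ^κ ≤ 1 + 2M`
(`ξ ≤ 1`: `ξ^κ ≤ 1`; `ξ ≥ 1`: `ξ^{κ−1} ≤ 1` so `ξ < 1 + 2M`, and `ξ^κ ≤ ξ`), hence `h ≤ M(1+2M)/κ`. -/
theorem Q_ge_of_DK_lt_one {κ M ξ : ℝ} (hκ0 : 0 < κ) (hκ1 : κ ≤ 1) (hM : 0 < M) (hξ : 0 < ξ)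
    (hD : DK κ M ξ < 1) : 32 ≤ bigAK κ M * exp (-hK κ M ξ) := by
  have hpow : ξ ^ κ ≤ 1 + 2 * M := by
    rcases le_or_gt ξ 1 with h1 | h1
    · have := rpow_le_one hξ.le h1 hκ0.le
      linarith
    · have hk1 : ξ ^ (κ - 1) ≤ 1 := rpow_le_one_of_one_le_of_nonpos h1.le (by linarith)
      have hξlt : ξ < 1 + 2 * M := by
        unfold DK at hD
        nlinarith
      have hk : ξ ^ κ ≤ ξ ^ (1 : ℝ) := rpow_le_rpow_of_exponent_le h1.le hκ1
      rw [rpow_one] at hk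
      linarith
  have hh : hK κ M ξ ≤ M * (1 + 2 * M) / κ := by
    unfold hK
    rw [div_mul_eq_mul_div, div_le_div_iff_of_pos_right hκ0]
    exact mul_le_mul_of_nonneg_left hpow hM.le
  unfold bigAK
  rw [mul_assoc, ← exp_add]
  have : 0 ≤ M * (1 + 2 * M) / κ + -hK κ M ξ := by linarith
  have h1 : 1 ≤ exp (M * (1 + 2 * M) / κ + -hK κ M ξ) := one_le_exp this
  linarith

/-- **The Riccati inequality of the κ-recipe tail**: for `0 < κ ≤ 1`, `M > 0`, `ξ > 0`,
`φ_κ′ + (Mξ^{κ−1} − 1/ξ − ξ/2) φ_κ + m_κ φ_κ² ≤ −1`. (`riccati_abstract` on the atoms `D = DK`, `D′ = dDK`,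
`S = √(1+D²)`, `Q = A e^{−h}`.) [new] -/
theorem riccati_le_kappa {κ M ξ : ℝ} (hκ0 : 0 < κ) (hκ1 : κ ≤ 1) (hM : 0 < M) (hξ : 0 < ξ) :
    dphiK κ M ξ + (M * ξ ^ (κ - 1) - ξ⁻¹ - ξ / 2) * phiK κ M ξ + expoK κ M * phiK κ M ξ ^ 2 ≤ -1 := by
  set A := bigAK κ M with hA_def
  set m := expoK κ M with hm_def
  set D := DK κ M ξ with hD_def
  set D' := dDK κ M ξ with hD'_def
  set Q := bigAK κ M * exp (-hK κ M ξ) with hQ_def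
  set S := √(1 + DK κ M ξ ^ 2) with hS_def
  have hA : 0 < A := bigAK_pos κ M
  have hQ0 : 0 < Q := by rw [hQ_def]; positivity
  have hQA : Q ≤ A := by
    rw [hQ_def, hA_def]
    have hh : 0 ≤ hK κ M ξ := by unfold hK; positivity
    have : exp (-hK κ M ξ) ≤ 1 := by rw [exp_le_one_iff]; linarith
    have hA' := bigAK_pos κ M
    nlinarith
  have hS0 : 0 < S := by rw [hS_def]; positivity
  have hSD : S ^ 2 = 1 + D ^ 2 := by rw [hS_def, hD_def, sq_sqrt (by positivity)]
  have hE : M * ξ ^ (κ - 1) = (ξ - D) / 2 := by rw [hD_def]; unfold DK; ring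
  have key := riccati_abstract hξ hκ0 hκ1 (DK_lt (κ := κ) hM hξ) (dDK_eq (κ := κ) (M := M) hξ) hS0 hSD hQ0 hQA
    (expoK_pos κ M) (expoK_mul κ M) (fun hD1 => Q_ge_of_DK_lt_one hκ0 hκ1 hM hξ hD1)
  have expand : dphiK κ M ξ + (M * ξ ^ (κ - 1) - ξ⁻¹ - ξ / 2) * phiK κ M ξ + m * phiK κ M ξ ^ 2
      = -(Q * (ξ⁻¹ + ξ / 2)) - 2 * D * D' / S ^ 3 - D / S - 2 * ξ⁻¹ / S + m * (Q + 2 / S) ^ 2 := by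
    simp only [dphiK, phiK, ← hQ_def, ← hD_def, ← hD'_def, hE]
    ring
  rw [expand]
  exact key

end Summit.NavierStokesRegularity.NavierStokesRegularity.Theorems.ZhangBarrier

end
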